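import Literature.MathematicalPhysics.QuantumLattice.GrassmannWeightedCumulantBound
import Literature.MathematicalPhysics.QuantumLattice.GrassmannEffectiveActionBound
import HarnessLib

/-!
# The decay-weighted single-scale step: `Σ_W wt(W) ‖kernel_m (effAction C V) (W)‖ ≤ ρ^{-m} e‖V‖_{h,wt} / (1 - θ)`

Topic `Literature/MathematicalPhysics/QuantumLattice`; the WEIGHTED form of `GrassmannEffectiveActionBound.lean`
(Benfatto–Giuliani–Mastropietro 2006, (2.13)–(2.14), (2.77)–(2.80) and §3 (3.2)–(3.8): the decay / moment information
of the kernels of the effective potentials is propagated through the single-scale integration; Gentile–Mastropietro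
2001, §4).  For a tree weight `wt` on label sets (`SubmultiplicativeTreeWeight.lean` — e.g. `(1 + γ^h diam)^N`, whose
pair value dominates the moments `(γ^h |x - y|)^j`, `j ≤ N`), an even interaction `V` without constant term whose
kernels have `wt`-weighted pinned `L¹` norms `N(m')`, a charged covariance `C` in Gram form (constant `κ`) with row and
column sums of `‖C(X,Y)‖ wt{X,Y}` at most `α`, an output field weight `ρ > 0`, `‖V‖_h = Σ_{m'} (e²(κ+ρ))^{2m'} N(m')` and
`θ = e α ‖V‖_h / κ² < 1`: the normalised partition function is a unit and in every degree `m ≥ 1`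

`Σ_{W : W_i = w} wt(W) ‖kernel_m (effAction C V) (W)‖ ≤ ρ^{-m} · e ‖V‖_h / (1 - θ)`   (`sum_wt_norm_kernel_effAction_le`):

the unweighted statement `sum_norm_kernel_effAction_le` with `N`, `α` replaced by their weighted versions — the output
kernels inherit the decay of the inputs and of the tree lines at no cost in the constants.

Everything is proved; no definition.

## Sources

G. Benfatto, A. Giuliani, V. Mastropietro, Ann. Henri Poincaré 7 (2006) 809–898, (2.13)–(2.14), (2.77)–(2.80), §3 (3.2)–(3.8)
(`BenfattoGiulianiMastropietro2006`); G. Gentile, V. Mastropietro, Phys. Rep. 352 (2001) 273–437, §4 (`GentileMastropietro2001`);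
K. Gawȩdzki, A. Kupiainen, Comm. Math. Phys. 102 (1985) 1–30, §3 (`GawedzkiKupiainen1985GrossNeveu`).
-/

noncomputable section

namespace Literature.MathematicalPhysics.QuantumLattice

open GrassmannAlgebra Finset Literature.Probability.LatticeModels Literature.Probability.LatticeModels.BattleFederbush
open scoped InnerProductSpace Nat

variable {𝕜 : Type*} [RCLike 𝕜] {Γ : Type*} [Fintype Γ] [DecidableEq Γ] (C : Matrix Γ Γ 𝕜) {wt : Finset Γ → ℝ}

omit [Fintype Γ] in
/-- Weighted anchored sums dominate the unweighted ones (`wt ≥ 1`). [folklore] -/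
theorem sum_norm_le_sum_norm_mul_wt (hwt : IsTreeWeight wt) {m : ℕ} (s : Finset (Fin m → Γ)) (F : (Fin m → Γ) → 𝕜) :
    ∑ Y ∈ s, ‖F Y‖ ≤ ∑ Y ∈ s, ‖F Y‖ * wt (univ.image Y) :=
  sum_le_sum fun _ _ => le_mul_of_one_le_right (norm_nonneg _) (hwt.one_le _)

omit [Fintype Γ] in
/-- Weighted row sums dominate the unweighted ones (`wt ≥ 1`). [folklore] -/
theorem sum_norm_le_sum_norm_mul_wt_pair (hwt : IsTreeWeight wt) (s : Finset Γ) (F : Γ → 𝕜) (P : Γ → Finset Γ) :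
    ∑ Y ∈ s, ‖F Y‖ ≤ ∑ Y ∈ s, ‖F Y‖ * wt (P Y) :=
  sum_le_sum fun _ _ => le_mul_of_one_le_right (norm_nonneg _) (hwt.one_le _)

/-- **The decay-weighted single-scale renormalisation-group step** (Benfatto–Giuliani–Mastropietro 2006, (2.13)–(2.14)
with (2.77)–(2.80) and §3 (3.2)–(3.8)): for a tree weight `wt`, with `θ = e α ‖V‖_h / κ² < 1` (weighted norms), the
normalised partition function is a unit and
`Σ_{W : W_i = w} wt(W) ‖kernel_m (effAction C V) (W)‖ ≤ ρ^{-m} · e ‖V‖_h / (1 - θ)` in every degree `m ≥ 1`.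
[cite: BenfattoGiulianiMastropietro2006, (2.13)-(2.14), (2.77)-(2.80) and §3 (3.2)-(3.8)] -/
theorem sum_wt_norm_kernel_effAction_le {E : Type*} [NormedAddCommGroup E] [InnerProductSpace 𝕜 E] (hwt : IsTreeWeight wt)
    (q : Γ → Bool) (hC : ∀ X Y, q X = q Y → C X Y = 0) (f g : Γ → E) {κ : ℝ} (hκ : 0 < κ)
    (hf : ∀ X, q X = true → ‖f X‖ ≤ κ) (hg : ∀ Y, q Y = false → ‖g Y‖ ≤ κ)
    (hG : ∀ X Y, q X = true → q Y = false → contr 𝕜 C X Y = ⟪f X, g Y⟫_𝕜)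
    (V : GrassmannAlgebra 𝕜 Γ) (hV : V ∈ evenPart 𝕜 Γ) (hV0 : constPart 𝕜 V = 0) (N : ℕ → ℝ) (hN0 : ∀ m', 0 ≤ N m')
    (hN : ∀ m' (j : Fin (2 * m')) (w : Γ), ∑ Y ∈ univ.filter (fun Y : Fin (2 * m') → Γ => Y j = w),
      ‖kernel 𝕜 V (2 * m') Y‖ * wt (univ.image Y) ≤ N m')
    {α : ℝ} (hα : 0 < α) (hrow : ∀ X, ∑ Y, ‖C X Y‖ * wt {X, Y} ≤ α) (hcol : ∀ Y, ∑ X, ‖C X Y‖ * wt {X, Y} ≤ α) {ρ : ℝ} (hρ : 0 < ρ)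
    (hθ : Real.exp 1 * α * normV Γ κ ρ N / κ ^ 2 < 1) :
    IsUnit (effPartitionFn 𝕜 C V) ∧ ∀ {m : ℕ}, 0 < m → ∀ (i : Fin m) (w : Γ),
      ∑ W ∈ univ.filter (fun W : Fin m → Γ => W i = w), wt (univ.image W) * ‖kernel 𝕜 (effAction 𝕜 C V) m W‖ ≤
        ρ⁻¹ ^ m * (Real.exp 1 * normV Γ κ ρ N) / (1 - Real.exp 1 * α * normV Γ κ ρ N / κ ^ 2) := by
  -- notation
  set X : evenPart 𝕜 Γ := ⟨-V, neg_mem hV⟩ with hX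
  set degs : Finset ℕ := range (Fintype.card Γ / 2 + 1) with hdegs
  set K : (m' : ℕ) → (Fin (2 * m') → Γ) → 𝕜 := fun m' => kernel 𝕜 (-V) (2 * m') with hK
  set nV : ℝ := normV Γ κ ρ N with hnV
  set θ : ℝ := Real.exp 1 * α * nV / κ ^ 2 with hθdef
  have hnV0 : 0 ≤ nV := normV_nonneg hκ.le hρ.le hN0
  have hθ0 : 0 ≤ θ := by positivity
  have hθ1 : θ < 1 := hθ
  have hnVsum : ∑ m' ∈ degs, (Real.exp 2 * (κ + ρ)) ^ (2 * m') * N m' = nV := rfl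
  have hexpn : ∀ k : ℕ, Real.exp k = Real.exp 1 ^ k := fun k => by rw [← Real.exp_nat_mul, mul_one]
  -- `-V` as the `vertexOf` of its kernels
  have hXv : vertexOf 𝕜 degs K = X := Subtype.ext (coe_vertexOf_kernel_eq 𝕜 X)
  have hKnorm : ∀ (m' : ℕ) (Y : Fin (2 * m') → Γ), ‖K m' Y‖ = ‖kernel 𝕜 V (2 * m') Y‖ := by
    intro m' Y
    rw [hK]
    dsimp only
    rw [show -V = (-1 : 𝕜) • V from (neg_one_smul 𝕜 V).symm, kernel_smul, norm_mul, norm_neg, norm_one, one_mul]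
  have hNw : ∀ (m' : ℕ) (j : Fin (2 * m')) (w : Γ), ∑ Y ∈ univ.filter (fun Y : Fin (2 * m') → Γ => Y j = w), ‖K m' Y‖ * wt (univ.image Y) ≤ N m' := by
    intro m' j w
    simp only [hKnorm]
    exact hN m' j w
  -- the unweighted hypotheses follow from the weighted ones (`wt ≥ 1`)
  have hN' : ∀ (m' : ℕ) (j : Fin (2 * m')) (w : Γ), ∑ Y ∈ univ.filter (fun Y : Fin (2 * m') → Γ => Y j = w), ‖K m' Y‖ ≤ N m' :=
    fun m' j w => (sum_norm_le_sum_norm_mul_wt hwt _ _).trans (hNw m' j w)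
  have hrow' : ∀ X, ∑ Y, ‖C X Y‖ ≤ α := fun X => (sum_norm_le_sum_norm_mul_wt_pair hwt univ (fun Y => C X Y) fun Y => {X, Y}).trans (hrow X)
  have hcol' : ∀ Y, ∑ X, ‖C X Y‖ ≤ α := fun Y => (sum_norm_le_sum_norm_mul_wt_pair hwt univ (fun X => C X Y) fun X => {X, Y}).trans (hcol Y)
  have hK0 : ∀ Y, K 0 Y = 0 := fun Y => by
    rw [hK]
    dsimp only
    rw [kernel_zero, map_neg, hV0, neg_zero]
  -- the cumulants and their weighted bounds
  set κs : ℕ → evenPart 𝕜 Γ := fun n => cumulantOf (fun k => evenGaussConv 𝕜 C (X ^ k)) n with hκs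
  have hκs_eq : ∀ n, κs n = cumulantOf (fun k => evenGaussConv 𝕜 C (vertexOf 𝕜 degs K ^ k)) n := fun n => by rw [hXv]
  have hbd : ∀ {n : ℕ}, 0 < n → ∀ {m : ℕ} (i : Fin m) (w : Γ),
      ∑ W ∈ univ.filter (fun W : Fin m → Γ => W i = w), wt (univ.image W) * ‖kernel 𝕜 ((κs n : evenPart 𝕜 Γ) : GrassmannAlgebra 𝕜 Γ) m W‖ ≤
        (n ! : ℝ) * (ρ⁻¹ ^ m * (κ ^ 2 / α) * θ ^ n) := by
    intro n hn m i w
    have h := sum_wt_norm_kernel_cumulantOf_le_pow C hwt q hC f g hκ hf hg hG degs K N hN0 hNw hα hrow hcol hρ hn i w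
    rw [← hκs_eq, hnVsum] at h
    refine h.trans (le_of_eq ?_)
    obtain ⟨n', rfl⟩ : ∃ n', n = n' + 1 := ⟨n - 1, by omega⟩
    rw [hθdef, hexpn, Nat.add_sub_cancel, div_pow, inv_pow, inv_pow]
    field_simp
    ring
  -- a single weighted term is at most the pinned weighted sum over its own fibre
  have hsingle : ∀ {n m : ℕ} (i : Fin m) (W : Fin m → Γ), wt (univ.image W) * ‖kernel 𝕜 ((κs n : evenPart 𝕜 Γ) : GrassmannAlgebra 𝕜 Γ) m W‖ ≤
      ∑ W' ∈ univ.filter (fun W' : Fin m → Γ => W' i = W i), wt (univ.image W') * ‖kernel 𝕜 ((κs n : evenPart 𝕜 Γ) : GrassmannAlgebra 𝕜 Γ) m W'‖ :=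
    fun i W => single_le_sum (f := fun W' => wt (univ.image W') * ‖kernel 𝕜 ((κs _ : evenPart 𝕜 Γ) : GrassmannAlgebra 𝕜 Γ) _ W'‖)
      (fun W' _ => mul_nonneg (hwt.nonneg _) (norm_nonneg _)) (mem_filter.2 ⟨mem_univ _, rfl⟩)
  have hone : ∀ {n m : ℕ} (W : Fin m → Γ), ‖kernel 𝕜 ((κs n : evenPart 𝕜 Γ) : GrassmannAlgebra 𝕜 Γ) m W‖ ≤
      wt (univ.image W) * ‖kernel 𝕜 ((κs n : evenPart 𝕜 Γ) : GrassmannAlgebra 𝕜 Γ) m W‖ :=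
    fun W => le_mul_of_one_le_left (norm_nonneg _) (hwt.one_le _)
  have hbd0 : ∀ {n : ℕ}, 0 < n → ‖constPart 𝕜 ((κs n : evenPart 𝕜 Γ) : GrassmannAlgebra 𝕜 Γ)‖ ≤
      (n ! : ℝ) * ((Fintype.card Γ : ℝ) * (κ ^ 2 / α) * θ ^ n) := by
    intro n hn
    have h := norm_constPart_cumulantOf_le_pow C q hC f g hκ hf hg hG degs K hK0 N hN0 hN' hα hrow' hcol' hρ hn
    rw [← hκs_eq, hnVsum] at h
    refine h.trans (le_of_eq ?_)
    obtain ⟨n', rfl⟩ : ∃ n', n = n' + 1 := ⟨n - 1, by omega⟩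
    rw [hθdef, hexpn, Nat.add_sub_cancel, div_pow, inv_pow]
    field_simp
    ring
  have hgeom : Summable fun n : ℕ => θ ^ n := summable_geometric_of_lt_one hθ0 hθ1
  -- the kernel series converge absolutely (the hypothesis of the identification)
  have hsum : ∀ (m' : ℕ) (Y : Fin (2 * m') → Γ), Summable fun n : ℕ =>
      ‖kernel 𝕜 ((κs n : evenPart 𝕜 Γ) : GrassmannAlgebra 𝕜 Γ) (2 * m') Y‖ / n ! := by
    intro m' Y
    rw [← summable_nat_add_iff 1]
    rcases m' with _ | m'
    · refine Summable.of_nonneg_of_le (fun n => by positivity) (fun n => ?_) (hgeom.mul_left ((Fintype.card Γ : ℝ) * (κ ^ 2 / α) * θ))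
      have hk : kernel 𝕜 ((κs (n + 1) : evenPart 𝕜 Γ) : GrassmannAlgebra 𝕜 Γ) (2 * 0) Y =
          constPart 𝕜 ((κs (n + 1) : evenPart 𝕜 Γ) : GrassmannAlgebra 𝕜 Γ) := kernel_zero 𝕜 _ Y
      rw [hk, div_le_iff₀ (by positivity)]
      refine (hbd0 (n := n + 1) n.succ_pos).trans (le_of_eq ?_)
      rw [pow_succ]
      ring
    · refine Summable.of_nonneg_of_le (fun n => by positivity) (fun n => ?_) (hgeom.mul_left (ρ⁻¹ ^ (2 * (m' + 1)) * (κ ^ 2 / α) * θ))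
      rw [div_le_iff₀ (by positivity)]
      refine (((hone Y).trans (hsingle ⟨0, by omega⟩ Y)).trans (hbd (n := n + 1) n.succ_pos _ _)).trans (le_of_eq ?_)
      rw [pow_succ]
      ring
  -- the identification
  obtain ⟨hunit, hker⟩ := kernel_effAction_eq_neg_tsum 𝕜 Γ C V hV hV0 hsum
  refine ⟨hunit, @fun m hm i w => ?_⟩
  set a : ℕ → (Fin m → Γ) → 𝕜 := fun n W => if n = 0 then 0 else
    ((n ! : 𝕜))⁻¹ * kernel 𝕜 ((κs n : evenPart 𝕜 Γ) : GrassmannAlgebra 𝕜 Γ) m W with ha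
  have hanorm : ∀ n W, wt (univ.image W) * ‖a n W‖ =
      if n = 0 then 0 else (n ! : ℝ)⁻¹ * (wt (univ.image W) * ‖kernel 𝕜 ((κs n : evenPart 𝕜 Γ) : GrassmannAlgebra 𝕜 Γ) m W‖) := by
    intro n W
    rw [ha]
    dsimp only
    split_ifs
    · rw [norm_zero, mul_zero]
    · rw [norm_mul, norm_inv, RCLike.norm_natCast]; ring
  -- every weighted term is bounded by the weighted pinned sum over its own fibre
  have haW : ∀ n W, wt (univ.image W) * ‖a n W‖ ≤ ρ⁻¹ ^ m * (κ ^ 2 / α) * θ ^ n := by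
    intro n W
    rw [hanorm]
    split_ifs with hn
    · positivity
    · calc (n ! : ℝ)⁻¹ * (wt (univ.image W) * ‖kernel 𝕜 ((κs n : evenPart 𝕜 Γ) : GrassmannAlgebra 𝕜 Γ) m W‖)
          ≤ (n ! : ℝ)⁻¹ * ((n ! : ℝ) * (ρ⁻¹ ^ m * (κ ^ 2 / α) * θ ^ n)) :=
            mul_le_mul_of_nonneg_left ((hsingle i W).trans (hbd (Nat.pos_of_ne_zero hn) i (W i))) (by positivity)
        _ = ρ⁻¹ ^ m * (κ ^ 2 / α) * θ ^ n := by field_simp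
  have hsW : ∀ W, Summable fun n => wt (univ.image W) * ‖a n W‖ := fun W =>
    Summable.of_nonneg_of_le (fun n => mul_nonneg (hwt.nonneg _) (norm_nonneg _)) (fun n => haW n W) (hgeom.mul_left _)
  have hsW' : ∀ W, Summable fun n => ‖a n W‖ := fun W =>
    (hsW W).of_nonneg_of_le (fun n => norm_nonneg _) fun n => le_mul_of_one_le_left (norm_nonneg _) (hwt.one_le _)
  have hrowbd : ∀ n, ∑ W ∈ univ.filter (fun W : Fin m → Γ => W i = w), wt (univ.image W) * ‖a n W‖ ≤
      ρ⁻¹ ^ m * (κ ^ 2 / α) * (if n = 0 then 0 else θ ^ n) := by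
    intro n
    simp only [hanorm]
    split_ifs with hn
    · rw [sum_const_zero, mul_zero]
    · rw [← mul_sum]
      calc (n ! : ℝ)⁻¹ * ∑ W ∈ univ.filter (fun W : Fin m → Γ => W i = w),
              wt (univ.image W) * ‖kernel 𝕜 ((κs n : evenPart 𝕜 Γ) : GrassmannAlgebra 𝕜 Γ) m W‖
          ≤ (n ! : ℝ)⁻¹ * ((n ! : ℝ) * (ρ⁻¹ ^ m * (κ ^ 2 / α) * θ ^ n)) :=
            mul_le_mul_of_nonneg_left (hbd (Nat.pos_of_ne_zero hn) i w) (by positivity)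
        _ = ρ⁻¹ ^ m * (κ ^ 2 / α) * θ ^ n := by field_simp
  have hgeom' : Summable fun n : ℕ => ρ⁻¹ ^ m * (κ ^ 2 / α) * (if n = 0 then 0 else θ ^ n) := by
    refine (hgeom.mul_left (ρ⁻¹ ^ m * (κ ^ 2 / α))).of_nonneg_of_le (fun n => by positivity) fun n => ?_
    split_ifs
    · rw [mul_zero]; positivity
    · exact le_rfl
  have htsumθ : ∑' n : ℕ, (if n = 0 then (0 : ℝ) else θ ^ n) = θ * (1 - θ)⁻¹ := by
    have hs : Summable fun n : ℕ => (if n = 0 then (0 : ℝ) else θ ^ n) :=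
      hgeom.of_nonneg_of_le (fun n => by positivity) fun n => by
        split_ifs
        · positivity
        · exact le_rfl
    rw [hs.tsum_eq_zero_add]
    simp only [if_true, Nat.succ_ne_zero, if_false, zero_add, pow_succ', tsum_mul_left, tsum_geometric_of_lt_one hθ0 hθ1]
  calc ∑ W ∈ univ.filter (fun W : Fin m → Γ => W i = w), wt (univ.image W) * ‖kernel 𝕜 (effAction 𝕜 C V) m W‖
      = ∑ W ∈ univ.filter (fun W : Fin m → Γ => W i = w), wt (univ.image W) * ‖∑' n, a n W‖ :=
        sum_congr rfl fun W _ => by rw [hker hm W, norm_neg]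
    _ ≤ ∑ W ∈ univ.filter (fun W : Fin m → Γ => W i = w), ∑' n, wt (univ.image W) * ‖a n W‖ := by
        refine sum_le_sum fun W _ => ?_
        rw [tsum_mul_left]
        exact mul_le_mul_of_nonneg_left (norm_tsum_le_tsum_norm (hsW' W)) (hwt.nonneg _)
    _ = ∑' n, ∑ W ∈ univ.filter (fun W : Fin m → Γ => W i = w), wt (univ.image W) * ‖a n W‖ :=
        (Summable.tsum_finsetSum fun W _ => hsW W).symm
    _ ≤ ∑' n, ρ⁻¹ ^ m * (κ ^ 2 / α) * (if n = 0 then 0 else θ ^ n) :=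
        Summable.tsum_le_tsum hrowbd (summable_sum fun W _ => hsW W) hgeom'
    _ = ρ⁻¹ ^ m * (κ ^ 2 / α) * (θ * (1 - θ)⁻¹) := by rw [tsum_mul_left, htsumθ]
    _ = ρ⁻¹ ^ m * (Real.exp 1 * nV) / (1 - θ) := by
        rw [hθdef]
        field_simp

end Literature.MathematicalPhysics.QuantumLattice
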